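import Literature.Analysis.FunctionSpaces.LipschitzDomainCover
import HarnessLib

/-!
# Balls are Lipschitz domains

Analysis/FunctionSpaces support file (serves the decomposition of the ε-regularity criterion
`Literature.Analysis.FluidPDE.ckn_epsilon_regularity`, Caffarelli–Kohn–Nirenberg 1982, Prop. 2,
through the Sobolev inequality `H¹(B_r) ⊂ L⁶(B_r)` on balls; the statement is textbook
geometry).

The tree's Sobolev embedding, extension, trace, Rellich and Poincaré–Wirtinger theorems on
domains (`FunctionSpaces/SobolevTrace*`, `SteinExtension*`) are stated for bounded **Lipschitz
domains** in the sense of the accepted `Literature.Analysis.FunctionSpaces.IsLipschitzDomain`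
(`SobolevTrace`; Grisvard, *Elliptic problems in nonsmooth domains*, Def. 1.2.1.1: near every
boundary point the open set is, in a ball, the strict epigraph of a Lipschitz function in some
orthonormal direction). This file proves that every open ball of a real inner product space is
a Lipschitz domain (`isLipschitzDomain_ball`), so that those theorems apply to balls — the
domains of the local theory of the Navier–Stokes equations (Caffarelli–Kohn–Nirenberg 1982, §2,
(2.8)–(2.10): Sobolev inequalities on `B_r`).

## Proof

Let `p ∈ ∂B(x₀, R)`, so `R > 0` and `‖p - x₀‖ = R`; let `n = R⁻¹ (x₀ - p)` be the inward unit
normal at `p`, `P y = y - ⟪y, n⟫ n` the orthogonal projection onto `nᗮ`, `s₀ = ⟪x₀, n⟫`. For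
`y ∈ B(p, R/2)` one has `‖P y - P x₀‖ = ‖P (y - p)‖ < R/2` and `⟪y, n⟫ - s₀ = ⟪y - p, n⟫ - R < 0`,
and `‖y - x₀‖² = ‖P y - P x₀‖² + (⟪y, n⟫ - s₀)²`; hence `y ∈ B(x₀, R)` iff
`s₀ - ⟪y, n⟫ < √(R² - ‖P y - P x₀‖²)`, i.e. iff `γ(P y) < ⟪y, n⟫` for the lower-hemisphere
graph function `γ(w) = s₀ - √(R² - min(‖w - P x₀‖, R/2)²)`, which is `1`-Lipschitz on all of
`nᗮ` (indeed on `E'`): `t ↦ √(R² - t²)` is `1`-Lipschitz on `[0, R/2]` (derivative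
`-t / √(R² - t²)`, of modulus `≤ 1` there), and `w ↦ min(‖w - P x₀‖, R/2)` is `1`-Lipschitz with
values in `[0, R/2]` (Grisvard 1985, §1.2.1, the remark that convex/`C^{1,1}` domains are
Lipschitz; Evans, *PDE*, App. C.1).

## Mathlib search

Mathlib (this pin) has `frontier_ball`, `LipschitzWith.min_const`, `LipschitzWith.dist_left`,
`LipschitzOnWith.comp`, `Convex.lipschitzOnWith_of_nnnorm_hasDerivWithin_le`,
`HasDerivAt.sqrt`; no notion of Lipschitz domain (the tree's `IsLipschitzDomain` has so far only
the `C^k`-domain criterion `IsContDiffDomain.isLipschitzDomain_holds`).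

## References

* P. Grisvard, *Elliptic problems in nonsmooth domains* (Pitman, 1985), Def. 1.2.1.1, §1.2.1.
* L. C. Evans, *Partial Differential Equations*, 2nd ed. (2010), App. C.1.
* L. Caffarelli, R. Kohn, L. Nirenberg, *Partial regularity of suitable weak solutions of the
  Navier–Stokes equations*, Comm. Pure Appl. Math. 35 (1982), 771–831, §2, (2.8)–(2.10).
-/

noncomputable section

open Set Metric Topology TopologicalSpace
open scoped NNReal InnerProductSpace RealInnerProductSpace

namespace Literature.Analysis.FunctionSpaces

variable {E' : Type*} [NormedAddCommGroup E'] [InnerProductSpace ℝ E']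

/-! ### The graph function of a hemisphere -/

/-- `t ↦ √(R² - t²)` is `1`-Lipschitz on `[0, R/2]` (its derivative `-t/√(R² - t²)` has modulus
at most `1` there, as `2t² ≤ R²`). [folklore] -/
theorem lipschitzOnWith_sqrt_sq_sub_sq {R : ℝ} (hR : 0 < R) :
    LipschitzOnWith 1 (fun t : ℝ => √(R ^ 2 - t ^ 2)) (Icc 0 (R / 2)) := by
  have hpos : ∀ t ∈ Icc (0 : ℝ) (R / 2), 0 < R ^ 2 - t ^ 2 := by
    intro t ht; nlinarith [ht.1, ht.2]
  refine (convex_Icc 0 (R / 2)).lipschitzOnWith_of_nnnorm_hasDerivWithin_le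
    (f' := fun t => -(2 * t) / (2 * √(R ^ 2 - t ^ 2))) (fun t ht => ?_) (fun t ht => ?_)
  · have h1 : HasDerivAt (fun t : ℝ => R ^ 2 - t ^ 2) (-(2 * t)) t := by
      simpa using (hasDerivAt_pow 2 t).const_sub (R ^ 2)
    exact (h1.sqrt (hpos t ht).ne').hasDerivWithinAt
  · have hs : 0 < √(R ^ 2 - t ^ 2) := Real.sqrt_pos.2 (hpos t ht)
    have ht0 : 0 ≤ t := ht.1
    have hle : t ≤ √(R ^ 2 - t ^ 2) :=
      (Real.le_sqrt ht0 (hpos t ht).le).2 (by nlinarith [ht.1, ht.2])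
    rw [← NNReal.coe_le_coe, coe_nnnorm, NNReal.coe_one, Real.norm_eq_abs, abs_div, abs_neg,
      abs_of_nonneg (by positivity : (0 : ℝ) ≤ 2 * t),
      abs_of_pos (by positivity : (0 : ℝ) < 2 * √(R ^ 2 - t ^ 2)), div_le_one (by positivity)]
    linarith

omit [InnerProductSpace ℝ E'] in
/-- The lower-hemisphere graph function `γ(w) = s₀ - √(R² - min(dist(w, c), R/2)²)` is
`1`-Lipschitz on the whole space. [folklore] -/
theorem lipschitzWith_hemisphereGraph {R : ℝ} (hR : 0 < R) (s₀ : ℝ) (c : E') :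
    LipschitzWith 1 (fun w : E' => s₀ - √(R ^ 2 - (min (dist w c) (R / 2)) ^ 2)) := by
  have hm : LipschitzWith 1 (fun w : E' => min (dist w c) (R / 2)) :=
    (LipschitzWith.dist_left c).min_const (R / 2)
  have hmaps : MapsTo (fun w : E' => min (dist w c) (R / 2)) univ (Icc 0 (R / 2)) :=
    fun w _ => ⟨le_min dist_nonneg (by positivity), min_le_right _ _⟩
  have hcomp := (lipschitzOnWith_sqrt_sq_sub_sq hR).comp (hm.lipschitzOnWith (s := univ)) hmaps
  rw [one_mul, lipschitzOnWith_univ] at hcomp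
  have hF : LipschitzWith 1 (fun w : E' => √(R ^ 2 - (min (dist w c) (R / 2)) ^ 2)) := hcomp
  simpa using (LipschitzWith.const s₀).sub hF

/-! ### Orthogonal decomposition along a unit vector -/

/-- Pythagoras along a unit vector: `‖w‖² = ‖w - ⟪w, n⟫ n‖² + ⟪w, n⟫²`. [folklore] -/
theorem norm_sq_eq_norm_projAlong_sq_add {n : E'} (hn : ‖n‖ = 1) (w : E') :
    ‖w‖ ^ 2 = ‖w - ⟪w, n⟫ • n‖ ^ 2 + ⟪w, n⟫ ^ 2 := by
  rw [norm_sub_sq_real, real_inner_smul_right, norm_smul, Real.norm_eq_abs, hn, mul_one, sq_abs]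
  ring

/-! ### Balls -/

/-- **Open balls are Lipschitz domains**: for every `x₀` and every radius `R`, the open ball
`B(x₀, R)` of a real inner product space is a Lipschitz domain in the sense of the accepted
`IsLipschitzDomain` (near each boundary point `p`, inside `B(p, R/2)`, the ball is the strict
epigraph `{γ(P y) < ⟪y, n⟫}` of the `1`-Lipschitz lower-hemisphere function over the
hyperplane `nᗮ`, `n` the inward unit normal at `p`; for `R ≤ 0` the ball is empty and the
condition is vacuous). (Grisvard, *Elliptic problems in nonsmooth domains* (1985), §1.2.1;
Evans, *PDE*, App. C.1.) [cite: Grisvard1985, §1.2.1 (Def. 1.2.1.1)] -/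
theorem isLipschitzDomain_ball (x₀ : E') (R : ℝ) :
    IsLipschitzDomain (⟨ball x₀ R, isOpen_ball⟩ : Opens E') := by
  intro p hp
  change p ∈ frontier (ball x₀ R) at hp
  -- the radius is positive and `p` lies on the sphere
  have hR : 0 < R := by
    by_contra h
    rw [ball_eq_empty.2 (not_lt.1 h), frontier_empty] at hp
    exact hp
  rw [frontier_ball x₀ hR.ne', mem_sphere_iff_norm] at hp
  -- the inward unit normal and the projection onto its orthogonal complement
  set n : E' := R⁻¹ • (x₀ - p) with hn_def
  have hxp : x₀ - p = R • n := by
    rw [hn_def, smul_smul, mul_inv_cancel₀ hR.ne', one_smul]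
  have hn : ‖n‖ = 1 := by
    rw [hn_def, norm_smul, norm_inv, Real.norm_eq_abs, abs_of_pos hR, ← norm_neg, neg_sub, hp,
      inv_mul_cancel₀ hR.ne']
  set P : E' → E' := fun y => y - ⟪y, n⟫ • n with hP_def
  have hP : ∀ y, P y = y - ⟪y, n⟫ • n := fun y => rfl
  set s₀ : ℝ := ⟪x₀, n⟫ with hs₀
  set γ : E' → ℝ := fun w => s₀ - √(R ^ 2 - (min (dist w (P x₀)) (R / 2)) ^ 2) with hγ_def
  refine ⟨R / 2, by positivity, n, hn, γ, 1, lipschitzWith_hemisphereGraph hR s₀ (P x₀), ?_⟩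
  -- the key equivalence inside `B(p, R/2)`
  have key : ∀ y ∈ ball p (R / 2), y ∈ ball x₀ R ↔ γ (P y) < ⟪y, n⟫ := by
    intro y hy
    rw [mem_ball, dist_eq_norm] at hy
    -- the horizontal distance `d = ‖P y - P x₀‖ = ‖P (y - p)‖ < R/2`
    have hPd : P y - P x₀ = P (y - p) := by
      rw [projAlong_sub hP, show y - x₀ = (y - p) + (-R) • n by rw [neg_smul, ← hxp]; abel,
        projAlong_add_smul hn hP]
    have hd : dist (P y) (P x₀) < R / 2 := by
      rw [dist_eq_norm, hPd]
      exact (norm_projAlong_le hn hP _).trans_lt hy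
    have hd0 : 0 ≤ dist (P y) (P x₀) := dist_nonneg
    have hmin : min (dist (P y) (P x₀)) (R / 2) = dist (P y) (P x₀) := min_eq_left hd.le
    -- the vertical coordinate `⟪y, n⟫ - s₀ = ⟪y - p, n⟫ - R < 0`
    have hvert : ⟪y, n⟫ - s₀ = ⟪y - p, n⟫ - R := by
      have : y - x₀ = (y - p) - R • n := by rw [← hxp]; abel
      rw [hs₀, ← inner_sub_left, this, inner_sub_left, real_inner_smul_left,
        real_inner_self_eq_norm_sq, hn, one_pow, mul_one]
    have hneg : ⟪y, n⟫ - s₀ < 0 := by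
      have := (abs_inner_unit_le hn (y - p)).trans_lt hy
      rw [abs_lt] at this
      linarith [this.2]
    -- Pythagoras: `‖y - x₀‖² = d² + (⟪y, n⟫ - s₀)²`
    have hpyth : ‖y - x₀‖ ^ 2 = dist (P y) (P x₀) ^ 2 + (⟪y, n⟫ - s₀) ^ 2 := by
      rw [dist_eq_norm, projAlong_sub hP, hP (y - x₀), hs₀, ← inner_sub_left]
      exact norm_sq_eq_norm_projAlong_sq_add hn (y - x₀)
    have hR2 : 0 ≤ R ^ 2 - dist (P y) (P x₀) ^ 2 := by nlinarith [hd, hd0, hR]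
    -- the equivalence
    rw [mem_ball, dist_eq_norm, hγ_def]
    simp only [hmin]
    rw [show s₀ - √(R ^ 2 - dist (P y) (P x₀) ^ 2) < ⟪y, n⟫ ↔
        s₀ - ⟪y, n⟫ < √(R ^ 2 - dist (P y) (P x₀) ^ 2) by constructor <;> intro h <;> linarith,
      Real.lt_sqrt (by linarith), ← sq_lt_sq₀ (norm_nonneg _) hR.le, hpyth]
    constructor <;> intro h <;> nlinarith [h]
  -- the set identity
  ext y
  simp only [mem_inter_iff, mem_setOf_eq]
  constructor
  · rintro ⟨h1, h2⟩
    exact ⟨h2, (key y h2).1 h1⟩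
  · rintro ⟨h1, h2⟩
    exact ⟨(key y h1).2 h2, h1⟩

end Literature.Analysis.FunctionSpaces
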